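import Literature.MathematicalPhysics.QuantumFieldTheory.OSSectorContinuation
import HarnessLib

/-!
# Polynomial growth of the sector continuation (the maximum principle on the flat tubes with weights)

Topic `Literature/MathematicalPhysics/QuantumFieldTheory`; support file (all proved; no new
definitions; no named facts) for the discharge of (A1) `OS1975_exists_timeContinuation`, sequel of
`OSSectorContinuation`. Osterwalder–Schrader II (Comm. Math. Phys. 42 (1975)), Ch. VI.2, (6.21) and
(6.28) at the first step: the bound on the continued function is obtained from the bounds on the
generating flat tubes by the maximum principle *after multiplication by a weight which makes the
function bounded* ((6.21): `S_{k,ε}(ζ) = [∏ …]^{-kt} S_k(ζ + ε)`). Here the weight is the holomorphic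
damping `∏ⱼ dC(wⱼ)^{p+1}` of `OSSectorContinuation`:

* `IsSectorData.damp` — the damped data `(dampS, dampE)` of sector data with constants `(C₀, p, Csec)`
  are sector data with constants `(C₀, 0, Csec)` (bounded);
* `inv_norm_dC_le` — `‖dC w‖⁻¹ ≤ 2 (|w| + |w|⁻¹)` on `{Re w > 0}`;
* `IsSectorData.norm_extension_le_gFactor` — **polynomial growth of the continuation**: if `G` is
  holomorphic on the sector region of opening `a ≤ π/2` and equal to `S` at the positive real points,
  then for `0 < c < a`, on the sector region of opening `c`,
  `‖G w‖ ≤ max C₀ (Csec c) · 2^{(m+1)(p+1)} · Π(w)^{p+1}` — the growth class of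
  `OSContinuationBounds.IsOSGrowth` at level `0`, with an explicit constant.

## References

* K. Osterwalder, R. Schrader, *Axioms for Euclidean Green's functions II*, Comm. Math. Phys.
  42 (1975) 281–305, Ch. VI.2 (6.15), (6.21), (6.28). [OsterwalderSchraderCMP1975]
-/

noncomputable section

open MeasureTheory Set Filter Real
open _root_.Topology
open scoped NNReal SchwartzMap ContDiff

namespace Literature.MathematicalPhysics.QuantumFieldTheory.LogSlot

open Literature.Analysis.Complex Literature.MathematicalPhysics.QuantumFieldTheory.OSEnvelope

variable {m : ℕ} {a : ℝ} {S : (Fin (m + 1) → ℝ) → ℂ} {E : Fin (m + 1) → (Fin m → ℝ) → ℂ → ℂ}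
  {C₀ : ℝ} {p : ℕ} {Csec : ℝ → ℝ}

/-- **The damped data are bounded sector data.** [cite: OsterwalderSchraderCMP1975, Ch. VI.2 (6.21)] -/
theorem IsSectorData.damp (h : IsSectorData a S E C₀ p Csec) (ha0 : 0 < a) :
    IsSectorData a (dampS p S) (dampE a p E) C₀ 0 Csec where
  cont := (continuous_dampS h.C₀_nonneg h.cont h.bound).continuousOn
  C₀_nonneg := h.C₀_nonneg
  bound u _ := by simpa using norm_dampS_le h.C₀_nonneg h.bound u
  slot_cont i τ _ := (continuous_dampE h.Csec_nonneg h.slot_cont h.slot_bound i τ).continuousOn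
  slot_holo i u' _ := differentiableOn_dampE h.slot_holo i u'
  Csec_nonneg := h.Csec_nonneg
  slot_bound i c hc u' τ _ hτ hτc := by
    simpa using norm_dampE_le h.Csec_nonneg h.slot_bound i hc u' hτ hτc
  slot_real i u' hu' x hx := dampE_real ha0 h.slot_real i u' x hx.le

/-- `2 ≤ r + r⁻¹` for `r > 0`. [folklore] -/
theorem two_le_add_inv {r : ℝ} (hr : 0 < r) : 2 ≤ r + r⁻¹ := by
  have h : 0 ≤ (r - 1) ^ 2 / r := by positivity
  have h2 : (r - 1) ^ 2 / r = r + r⁻¹ - 2 := by field_simp; ring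
  linarith

/-- **The inverse of the damping is of linear growth**: `‖dC w‖⁻¹ ≤ 2 (|w| + |w|⁻¹)` for `Re w > 0`. [folklore] -/
theorem inv_norm_dC_le {w : ℂ} (hw : 0 < w.re) : ‖dC w‖⁻¹ ≤ 2 * (‖w‖ + ‖w‖⁻¹) := by
  have hw0 : w ≠ 0 := fun h => by rw [h] at hw; simp at hw
  have hn : 0 < ‖w‖ := norm_pos_iff.2 hw0
  have hdC : 0 < ‖dC w‖ := norm_pos_iff.2 (dC_ne_zero hw)
  rw [dC, norm_div, norm_pow, inv_div]
  have h1 : ‖1 + w‖ ≤ 1 + ‖w‖ := (norm_add_le _ _).trans (by simp)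
  calc ‖1 + w‖ ^ 2 / ‖w‖ ≤ (1 + ‖w‖) ^ 2 / ‖w‖ := by gcongr
    _ = ‖w‖ + ‖w‖⁻¹ + 2 := by field_simp; ring
    _ ≤ 2 * (‖w‖ + ‖w‖⁻¹) := by linarith [two_le_add_inv hn]

/-- The inverse of the product weight is of polynomial growth:
`(∏ⱼ ‖dC wⱼ‖^{p+1})⁻¹ ≤ 2^{(m+1)(p+1)} Π(w)^{p+1}`. [folklore] -/
theorem inv_norm_prod_dC_pow_le {w : Fin (m + 1) → ℂ} (hw : ∀ j, 0 < (w j).re) (p : ℕ) :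
    (∏ j, ‖dC (w j)‖ ^ (p + 1))⁻¹ ≤ (2 : ℝ) ^ ((m + 1) * (p + 1)) * gFactor w ^ (p + 1) := by
  rw [← Finset.prod_inv_distrib]
  calc ∏ j, (‖dC (w j)‖ ^ (p + 1))⁻¹ ≤ ∏ j, (2 * (‖w j‖ + ‖w j‖⁻¹)) ^ (p + 1) := by
        refine Finset.prod_le_prod (fun j _ => by positivity) fun j _ => ?_
        rw [← inv_pow]
        exact pow_le_pow_left₀ (by positivity) (inv_norm_dC_le (hw j)) _
    _ = (2 : ℝ) ^ ((m + 1) * (p + 1)) * gFactor w ^ (p + 1) := by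
        rw [Finset.prod_pow, Finset.prod_mul_distrib, Finset.prod_const, Finset.card_univ,
          Fintype.card_fin, mul_pow, ← pow_mul, gFactor]

/-- **Polynomial growth of the sector continuation** (the maximum principle on the flat tubes with
the weight `∏ⱼ dC(wⱼ)^{p+1}`): let `G` be holomorphic on the sector region of opening `a ≤ π/2` and
equal to `S` at the positive real points, for sector data of opening `a` with constants `(C₀, p, Csec)`.
Then for `0 < c < a`, on the sector region of opening `c`,
`‖G w‖ ≤ max C₀ (Csec c) · 2^{(m+1)(p+1)} · Π(w)^{p+1}`. [cite: OsterwalderSchraderCMP1975, Ch. VI.2 (6.15), (6.21), (6.28)] -/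
theorem IsSectorData.norm_extension_le_gFactor (h : IsSectorData a S E C₀ p Csec) (ha0 : 0 < a)
    (ha : a ≤ π / 2) {G : (Fin (m + 1) → ℂ) → ℂ} (hG : DifferentiableOn ℂ G (sectorRegion m a))
    (hGreal : ∀ u : Fin (m + 1) → ℝ, (∀ j, 0 < u j) → G (fun j => (u j : ℂ)) = S u)
    {c : ℝ} (hc0 : 0 < c) (hca : c < a) {w : Fin (m + 1) → ℂ} (hw : w ∈ sectorRegion m c) :
    ‖G w‖ ≤ max C₀ (Csec c) * (2 : ℝ) ^ ((m + 1) * (p + 1)) * gFactor w ^ (p + 1) := by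
  -- the weighted function
  set D : (Fin (m + 1) → ℂ) → ℂ := fun w => ∏ j, dC (w j) ^ (p + 1) with hD
  have hDd : DifferentiableOn ℂ D (sectorRegion m a) :=
    differentiableOn_finset_prod_fun _ fun j _ => DifferentiableOn.pow
      (differentiableOn_dC.comp (differentiableOn_pi.1 differentiableOn_id j) fun w hw => hw.1 j) _
  have hGD : DifferentiableOn ℂ (fun w => G w * D w) (sectorRegion m a) := hG.mul hDd
  have hGDreal : ∀ u : Fin (m + 1) → ℝ, (∀ j, 0 < u j) → (fun w => G w * D w) (fun j => (u j : ℂ)) = dampS p S u := by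
    intro u hu
    show G (fun j => (u j : ℂ)) * D (fun j => (u j : ℂ)) = dampS p S u
    rw [hGreal u hu, dampS, if_pos hu, mul_comm]
    simp only [hD, dC_ofReal]
  -- the maximum principle for the damped data
  set M : ℝ := max C₀ (Csec c) with hM
  have hb := (h.damp ha0).norm_extension_le ha hGD hGDreal hc0 hca (M := M)
    (fun u hu => by
      have := norm_dampS_le h.C₀_nonneg h.bound u
      rw [pow_zero, mul_one] at this
      exact this.trans (le_max_left _ _))
    (fun i u' τ hu hτ hτc => by
      have := norm_dampE_le h.Csec_nonneg h.slot_bound i hca u' hτ hτc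
      rw [pow_zero, mul_one] at this
      exact this.trans (le_max_right _ _)) hw
  -- undo the weight
  have hwre : ∀ j, 0 < (w j).re := hw.1
  have hDpos : 0 < ∏ j, ‖dC (w j)‖ ^ (p + 1) :=
    Finset.prod_pos fun j _ => pow_pos (norm_pos_iff.2 (dC_ne_zero (hwre j))) _
  have hnD : ‖D w‖ = ∏ j, ‖dC (w j)‖ ^ (p + 1) := by rw [hD]; simp [norm_prod, norm_pow]
  have hb' : ‖G w‖ * ∏ j, ‖dC (w j)‖ ^ (p + 1) ≤ M := by
    have : ‖G w * D w‖ ≤ M := hb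
    rwa [norm_mul, hnD] at this
  have hM0 : 0 ≤ M := h.C₀_nonneg.trans (le_max_left _ _)
  calc ‖G w‖ = ‖G w‖ * (∏ j, ‖dC (w j)‖ ^ (p + 1)) * (∏ j, ‖dC (w j)‖ ^ (p + 1))⁻¹ := by
        rw [mul_inv_cancel_right₀ hDpos.ne']
    _ ≤ M * (∏ j, ‖dC (w j)‖ ^ (p + 1))⁻¹ := mul_le_mul_of_nonneg_right hb' (by positivity)
    _ ≤ M * ((2 : ℝ) ^ ((m + 1) * (p + 1)) * gFactor w ^ (p + 1)) :=
        mul_le_mul_of_nonneg_left (inv_norm_prod_dC_pow_le hwre p) hM0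
    _ = max C₀ (Csec c) * (2 : ℝ) ^ ((m + 1) * (p + 1)) * gFactor w ^ (p + 1) := by rw [hM]; ring

end Literature.MathematicalPhysics.QuantumFieldTheory.LogSlot
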